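import Mathlib.Combinatorics.SimpleGraph.Maps
import Mathlib.Data.Fin.Tuple.Sort
import Mathlib.Data.Finset.Max
import Literature.Computability.Complexity.GraphCanonization
import HarnessLib

/-!
# Individualization–refinement search trees are isomorphism-invariant (McKay–Piperno 2014, §2.3)

The generic correctness core of canonical LABELING algorithms of the individualization–refinement
type (McKay 1981; McKay–Piperno 2014, §2: "the search tree which is at the heart of most recent
graph isomorphism algorithms"; the same shape as the vertex-selection/refinement procedures of
Corneil–Goldberg 1984). For a vertex-coloured graph `(G, π)` on `Fin k` one is given

* a REFINEMENT FUNCTION `R(G, π, ν) : Fin k → ℕ` of the sequence `ν` of individualized vertices,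
  label-invariant ((R3) of [MP14, §2.3]: `R(Gᵍ, πᵍ, νᵍ) = R(G, π, ν)ᵍ`), and
* a TARGET-CELL SELECTOR `T(G, π, ν) ⊆ Fin k` — the vertices to branch on — label-invariant
  ((T3)), empty exactly when `R(G, π, ν)` is discrete ((T1)–(T2)), and avoiding `ν`;

the SEARCH TREE has the sequences `ν` as nodes, root `()`, children `ν‖w` for `w ∈ T(G, π, ν)`;
its leaves carry discrete colourings, i.e. labelings. We formalize this as a structure
`IRScheme k` (the two functions and the four laws, stated in PULLBACK form along
`e : Fin k ≃ Fin k`: the relabelled coloured graph is `(G.comap e, π ∘ e)`, the relabelled sequence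
`ν.map e⁻¹`), and prove

* `IRScheme.nodes_comap`, `IRScheme.leafSeqs_comap` — **Lemma 1 of [MP14]**: the search tree of the
  relabelled graph is the relabelled search tree, `𝒯(Gᵍ, πᵍ) = 𝒯(G, π)ᵍ`;
* `IRScheme.leafLabelings` — the labelings `Tuple.sort (R(G, π, ν))` ("a discrete colouring is a
  permutation", [MP14, §2.2]) at the leaves, and **`IRScheme.leafLabelings_comap`** — they form an
  EQUIVARIANT set: `L(G.comap e, π ∘ e) = L(G, π) · e⁻¹`;
* `IRScheme.leafSeqs_nonempty` — the tree has a leaf (nodes are sequences of distinct vertices, so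
  the depth is at most `k`, and a deepest node has no children, hence is a leaf);
* **`IRScheme.leafLabelings_isLabelingSet`** — for a family of schemes `S k` (one per size), the
  labeling-set function `(k, G, col) ↦ (S k).leafLabelings G col` is nonempty-valued and
  equivariant in exactly the form consumed by `babaiLuks1983_canonicalForm_of_leader`
  (`GraphCanonizationProofs.lean`) and `leader_isCanonicalForm` (`GraphCanonizationLeader.lean`):
  the lexicographic leader over the leaves of ANY such scheme is a canonical form
  ([MP14, Lemma 4], with the leader as node invariant).

(R1) of [MP14] (`R(G, π, ν)` finer than `π`) is not needed for these facts and is not assumed. Not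
here: any particular refinement function (colour refinement, [MP14, §3.1]) or selector, pruning
([MP14, §2.4 (A)–(C)]), and bounds on the number of leaves (algorithm-specific; e.g.
Corneil–Goldberg's `cⁿ`).

## References

* B. D. McKay, A. Piperno, *Practical graph isomorphism, II*, J. Symbolic Comput. 60 (2014)
  94–112, doi:10.1016/j.jsc.2013.09.003, arXiv:1301.1493 — §2.2 (actions, canonical forms (C1),
  (C2)), §2.3 (refinement functions (R1)–(R3), target cell selectors (T1)–(T3), the search tree),
  Lemma 1, Lemma 4. [MckayPiperno2014]
* L. Babai, E. M. Luks, *Canonical labeling of graphs*, STOC 1983, §1. [BabaiLuks1983]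
-/

namespace Literature.Computability.Complexity

open _root_.Computability

/-- **An individualization–refinement scheme** on coloured graphs with vertex set `Fin k`
([MP14, §2.3]): a refinement function `refine G π ν` (the colouring attached to the node `ν`,
a sequence of individualized vertices) and a target-cell selector `target G π ν` (the vertices
to branch on at `ν`), subject to: label-invariance of both, in pullback form along
`e : Fin k ≃ Fin k` — (R3) `refine (G.comap e) (π ∘ e) (ν.map e⁻¹) = refine G π ν ∘ e` and
(T3) `target (G.comap e) (π ∘ e) (ν.map e⁻¹) = e⁻¹ '' target G π ν`; (T1)–(T2) the target is
empty exactly when the colouring is discrete (injective); and the target avoids the vertices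
already in `ν` (in [MP14] a consequence of (R2) and (T2): it is a non-singleton cell while the
vertices of `ν` are singleton cells). [cite: MckayPiperno2014, §2.3 ((R1)–(R3), (T1)–(T3))] -/
structure IRScheme (k : ℕ) where
  /-- The refinement function `R(G, π, ν)`. -/
  refine : SimpleGraph (Fin k) → (Fin k → ℕ) → List (Fin k) → (Fin k → ℕ)
  /-- The target-cell selector `T(G, π, ν)`. -/
  target : SimpleGraph (Fin k) → (Fin k → ℕ) → List (Fin k) → Finset (Fin k)
  /-- (R3): label-invariance of the refinement function. -/
  refine_comap : ∀ (G : SimpleGraph (Fin k)) (π : Fin k → ℕ) (ν : List (Fin k)) (e : Equiv.Perm (Fin k)),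
    refine (G.comap e) (π ∘ e) (ν.map e.symm) = refine G π ν ∘ e
  /-- (T3): label-invariance of the target-cell selector. -/
  target_comap : ∀ (G : SimpleGraph (Fin k)) (π : Fin k → ℕ) (ν : List (Fin k)) (e : Equiv.Perm (Fin k)),
    target (G.comap e) (π ∘ e) (ν.map e.symm) = (target G π ν).image e.symm
  /-- (T1)–(T2): no branching exactly at discrete colourings. -/
  target_eq_empty_iff : ∀ (G : SimpleGraph (Fin k)) (π : Fin k → ℕ) (ν : List (Fin k)),
    target G π ν = ∅ ↔ Function.Injective (refine G π ν)
  /-- Branching vertices are new. -/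
  not_mem_of_mem_target : ∀ (G : SimpleGraph (Fin k)) (π : Fin k → ℕ) (ν : List (Fin k)),
    ∀ w ∈ target G π ν, w ∉ ν

namespace IRScheme

variable {k : ℕ} (S : IRScheme k)

/-! ### The search tree -/

/-- The nodes of depth `d` of the search tree `𝒯(G, π)`: the root `()` at depth `0`, and the
children `ν ‖ w`, `w ∈ target G π ν`, of the nodes `ν` of depth `d`. [cite: MckayPiperno2014, §2.3 (the search tree, (a)–(b))] -/
def nodes (G : SimpleGraph (Fin k)) (π : Fin k → ℕ) : ℕ → Finset (List (Fin k))
  | 0 => {[]}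
  | d + 1 => (nodes G π d).biUnion fun ν => (S.target G π ν).image fun w => ν ++ [w]

/-- The root. [folklore] -/
@[simp] theorem nodes_zero (G : SimpleGraph (Fin k)) (π : Fin k → ℕ) : S.nodes G π 0 = {[]} := rfl

/-- The children. [folklore] -/
theorem nodes_succ (G : SimpleGraph (Fin k)) (π : Fin k → ℕ) (d : ℕ) :
    S.nodes G π (d + 1) = (S.nodes G π d).biUnion fun ν => (S.target G π ν).image fun w => ν ++ [w] := rfl

/-- Membership of a child. [folklore] -/
theorem mem_nodes_succ {G : SimpleGraph (Fin k)} {π : Fin k → ℕ} {d : ℕ} {ν' : List (Fin k)} :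
    ν' ∈ S.nodes G π (d + 1) ↔ ∃ ν ∈ S.nodes G π d, ∃ w ∈ S.target G π ν, ν ++ [w] = ν' := by
  simp only [nodes_succ, Finset.mem_biUnion, Finset.mem_image]

/-- The LEAVES of the search tree: the nodes (of depth at most `k`) without children, i.e. with
a discrete colouring. [cite: MckayPiperno2014, §2.3 ("ν is a leaf iff R(G, π₀, ν) is discrete")] -/
def leafSeqs (G : SimpleGraph (Fin k)) (π : Fin k → ℕ) : Finset (List (Fin k)) :=
  (Finset.range (k + 1)).biUnion fun d => (S.nodes G π d).filter fun ν => S.target G π ν = ∅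

/-- Membership in the leaf set. [folklore] -/
theorem mem_leafSeqs {G : SimpleGraph (Fin k)} {π : Fin k → ℕ} {ν : List (Fin k)} :
    ν ∈ S.leafSeqs G π ↔ ∃ d, d ≤ k ∧ ν ∈ S.nodes G π d ∧ S.target G π ν = ∅ := by
  simp only [leafSeqs, Finset.mem_biUnion, Finset.mem_range, Finset.mem_filter, Nat.lt_succ_iff]

/-- At a leaf the colouring is discrete. [cite: MckayPiperno2014, §2.3 (T1)–(T2)] -/
theorem injective_refine_of_mem_leafSeqs {G : SimpleGraph (Fin k)} {π : Fin k → ℕ} {ν : List (Fin k)}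
    (h : ν ∈ S.leafSeqs G π) : Function.Injective (S.refine G π ν) := by
  obtain ⟨-, -, -, h⟩ := S.mem_leafSeqs.1 h
  exact (S.target_eq_empty_iff G π ν).1 h

/-- **The labelings at the leaves**: a discrete colouring is a permutation — `Tuple.sort` of the
colouring lists the vertices by increasing colour (new label `i` ↦ the vertex of `i`-th smallest
colour). [cite: MckayPiperno2014, §2.2 ("a discrete colouring is a permutation") and §2.4] -/
noncomputable def leafLabelings (G : SimpleGraph (Fin k)) (π : Fin k → ℕ) : Finset (Equiv.Perm (Fin k)) :=
  (S.leafSeqs G π).image fun ν => Tuple.sort (S.refine G π ν)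

/-! ### Lemma 1: the search tree is label-invariant -/

/-- Relabelling a child: `(ν ‖ w).map e⁻¹ = ν.map e⁻¹ ‖ e⁻¹ w`. [folklore] -/
theorem map_append_singleton (e : Equiv.Perm (Fin k)) (ν : List (Fin k)) (w : Fin k) :
    (ν ++ [w]).map e.symm = ν.map e.symm ++ [e.symm w] := by
  simp

/-- **Lemma 1 of McKay–Piperno** (nodes): the depth-`d` nodes of `𝒯(G.comap e, π ∘ e)` are the
relabelled depth-`d` nodes of `𝒯(G, π)`. [cite: MckayPiperno2014, Lemma 1] -/
theorem nodes_comap (G : SimpleGraph (Fin k)) (π : Fin k → ℕ) (e : Equiv.Perm (Fin k)) :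
    ∀ d, S.nodes (G.comap e) (π ∘ e) d = (S.nodes G π d).image (List.map e.symm)
  | 0 => by simp
  | d + 1 => by
    rw [nodes_succ, nodes_succ, nodes_comap G π e d, Finset.image_biUnion, Finset.biUnion_image]
    refine Finset.biUnion_congr rfl fun ν _ => ?_
    rw [S.target_comap, Finset.image_image, Finset.image_image]
    exact Finset.image_congr fun w _ => (map_append_singleton e ν w).symm

/-- **Lemma 1 of McKay–Piperno** (leaves): the leaves of `𝒯(G.comap e, π ∘ e)` are the relabelled
leaves of `𝒯(G, π)`. [cite: MckayPiperno2014, Lemma 1] -/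
theorem leafSeqs_comap (G : SimpleGraph (Fin k)) (π : Fin k → ℕ) (e : Equiv.Perm (Fin k)) :
    S.leafSeqs (G.comap e) (π ∘ e) = (S.leafSeqs G π).image (List.map e.symm) := by
  rw [leafSeqs, leafSeqs, Finset.biUnion_image]
  refine Finset.biUnion_congr rfl fun d _ => ?_
  rw [S.nodes_comap G π e d, Finset.filter_image]
  congr 1
  refine Finset.filter_congr fun ν _ => ?_
  rw [S.target_comap, Finset.image_eq_empty]

/-- Sorting a relabelled injective tuple: `sort (f ∘ e) = (sort f) · e⁻¹`. [folklore] -/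
theorem sort_comp_equiv {f : Fin k → ℕ} (hf : Function.Injective f) (e : Equiv.Perm (Fin k)) :
    Tuple.sort (f ∘ e) = (Tuple.sort f).trans e.symm := by
  have h := Tuple.comp_perm_comp_sort_eq_comp_sort (f := f) (σ := e)
  refine Equiv.ext fun i => ?_
  have hi : e (Tuple.sort (f ∘ ⇑e) i) = Tuple.sort f i := hf (congrFun h i)
  rw [Equiv.trans_apply, ← hi, Equiv.symm_apply_apply]

/-- **The leaf labelings are equivariant**: `L(G.comap e, π ∘ e) = { s · e⁻¹ : s ∈ L(G, π) }`
((R3) at the leaves, and `sort (ρ ∘ e) = sort ρ · e⁻¹` for the discrete colourings `ρ`).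
[cite: MckayPiperno2014, Lemma 1 and §2.4] -/
theorem leafLabelings_comap (G : SimpleGraph (Fin k)) (π : Fin k → ℕ) (e : Equiv.Perm (Fin k)) :
    S.leafLabelings (G.comap e) (π ∘ e) = (S.leafLabelings G π).image fun s => s.trans e.symm := by
  rw [leafLabelings, leafLabelings, leafSeqs_comap, Finset.image_image, Finset.image_image]
  refine Finset.image_congr fun ν hν => ?_
  rw [Function.comp_apply, Function.comp_apply, S.refine_comap]
  exact sort_comp_equiv (S.injective_refine_of_mem_leafSeqs (Finset.mem_coe.1 hν)) e

/-! ### The tree has a leaf -/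

/-- Nodes of depth `d` are sequences of `d` distinct vertices. [cite: MckayPiperno2014, §2.3 ((R2), (T2))] -/
theorem nodup_length_of_mem_nodes (G : SimpleGraph (Fin k)) (π : Fin k → ℕ) :
    ∀ (d : ℕ) (ν : List (Fin k)), ν ∈ S.nodes G π d → ν.Nodup ∧ ν.length = d
  | 0, ν, h => by
    rw [nodes_zero, Finset.mem_singleton] at h
    subst h
    simp
  | d + 1, ν', h => by
    obtain ⟨ν, hν, w, hw, rfl⟩ := S.mem_nodes_succ.1 h
    obtain ⟨hnd, hlen⟩ := nodup_length_of_mem_nodes G π d ν hν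
    refine ⟨?_, by simp [hlen]⟩
    rw [List.nodup_append]
    exact ⟨hnd, List.nodup_singleton w, fun v hv x hx => by
      rw [List.mem_singleton] at hx
      subst hx
      exact fun hvw => S.not_mem_of_mem_target G π ν x hw (hvw ▸ hv)⟩

/-- There are no nodes of depth `k + 1` (a sequence of distinct vertices of `Fin k` has length at
most `k`). [folklore] -/
theorem nodes_eq_empty (G : SimpleGraph (Fin k)) (π : Fin k → ℕ) : S.nodes G π (k + 1) = ∅ := by
  refine Finset.eq_empty_of_forall_notMem fun ν hν => ?_
  obtain ⟨hnd, hlen⟩ := S.nodup_length_of_mem_nodes G π (k + 1) ν hν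
  have := hnd.length_le_card
  rw [Fintype.card_fin] at this
  omega

/-- A node without children is a leaf; a node with a child is not deepest. [folklore] -/
theorem mem_nodes_succ_of_mem_target {G : SimpleGraph (Fin k)} {π : Fin k → ℕ} {d : ℕ} {ν : List (Fin k)}
    (hν : ν ∈ S.nodes G π d) {w : Fin k} (hw : w ∈ S.target G π ν) : ν ++ [w] ∈ S.nodes G π (d + 1) :=
  S.mem_nodes_succ.2 ⟨ν, hν, w, hw, rfl⟩

/-- **The search tree has a leaf**: a deepest node has no children. [cite: MckayPiperno2014, §2.3] -/
theorem leafSeqs_nonempty (G : SimpleGraph (Fin k)) (π : Fin k → ℕ) : (S.leafSeqs G π).Nonempty := by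
  classical
  -- the first depth without nodes is positive and at most `k + 1`
  have hex : ∃ d, S.nodes G π d = ∅ := ⟨k + 1, S.nodes_eq_empty G π⟩
  have hm0 : 0 < Nat.find hex := by
    rw [Nat.pos_iff_ne_zero]
    intro h0
    have : S.nodes G π (Nat.find hex) = ∅ := Nat.find_spec hex
    rw [h0, nodes_zero] at this
    exact Finset.singleton_ne_empty _ this
  obtain ⟨d, hd'⟩ : ∃ d, Nat.find hex = d + 1 := ⟨Nat.find hex - 1, by omega⟩
  have hd : ¬ S.nodes G π d = ∅ := Nat.find_min hex (show d < Nat.find hex by omega)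
  have hd1 : S.nodes G π (d + 1) = ∅ := hd' ▸ Nat.find_spec hex
  have hdk : d ≤ k := by
    have : Nat.find hex ≤ k + 1 := Nat.find_min' hex (S.nodes_eq_empty G π)
    omega
  -- a deepest node has no children, hence is a leaf
  obtain ⟨ν, hν⟩ := Finset.nonempty_iff_ne_empty.2 hd
  refine ⟨ν, S.mem_leafSeqs.2 ⟨d, hdk, hν, ?_⟩⟩
  refine Finset.eq_empty_of_forall_notMem fun w hw => ?_
  have := S.mem_nodes_succ_of_mem_target hν hw
  rw [hd1] at this
  exact Finset.notMem_empty _ this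

/-- Hence the set of leaf labelings is nonempty. [cite: MckayPiperno2014, §2.4] -/
theorem leafLabelings_nonempty (G : SimpleGraph (Fin k)) (π : Fin k → ℕ) : (S.leafLabelings G π).Nonempty :=
  (S.leafSeqs_nonempty G π).image _

end IRScheme

/-! ### Families of schemes: the labeling-set function of `babaiLuks1983_canonicalForm_of_leader` -/

/-- **Equivariance along colour-preserving isomorphisms** (the form consumed by
`leader_isCanonicalForm` / `babaiLuks1983_canonicalForm_of_leader`): for `σ : G₁ ≃g G₂` with
`c₂ ∘ σ = c₁`, the leaf labelings of `(G₂, c₂)` are those of `(G₁, c₁)` translated by `σ`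
(as `(G₁, c₁) = (G₂.comap σ, c₂ ∘ σ)`). [cite: MckayPiperno2014, Lemma 1] -/
theorem IRScheme.leafLabelings_colIso {k : ℕ} (S : IRScheme k) {G₁ G₂ : SimpleGraph (Fin k)}
    {c₁ c₂ : Fin k → ℕ} (σ : G₁ ≃g G₂) (hσ : ∀ v, c₂ (σ v) = c₁ v) :
    S.leafLabelings G₂ c₂ = (S.leafLabelings G₁ c₁).image fun e => e.trans σ.toEquiv := by
  have hG : G₁ = G₂.comap σ.toEquiv := by
    ext u v
    simp only [SimpleGraph.comap_adj, RelIso.coe_fn_toEquiv]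
    exact σ.map_rel_iff.symm
  have hc : c₁ = c₂ ∘ σ.toEquiv := funext fun v => by simp [hσ]
  have key := S.leafLabelings_comap G₂ c₂ σ.toEquiv
  rw [← hG, ← hc] at key
  rw [key, Finset.image_image]
  symm
  convert Finset.image_id (s := S.leafLabelings G₂ c₂) using 2
  funext s
  simp [Function.comp_apply, Equiv.trans_assoc]

/-- **The leaves of an individualization–refinement scheme form a labeling set**: for a family of
schemes `S k`, one per number of vertices, the function `(k, G, col) ↦ (S k).leafLabelings G col`
is nonempty-valued and equivariant under colour-preserving isomorphisms — so, by
`leader_isCanonicalForm` (`GraphCanonizationLeader.lean`), the lexicographic leader over it is a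
canonical form ([MP14, Lemma 4] with the leader as node invariant), and by
`babaiLuks1983_canonicalForm_of_leader` (`GraphCanonizationProofs.lean`) an `FP` brick computing
that leader on padded codes proves `babaiLuks1983_canonicalForm`. [cite: MckayPiperno2014, Lemma 1 and Lemma 4] -/
theorem IRScheme.leafLabelings_isLabelingSet (S : ∀ k : ℕ, IRScheme k) :
    (∀ (k : ℕ) (G : SimpleGraph (Fin k)) (col : Fin k → ℕ), ((S k).leafLabelings G col).Nonempty) ∧
    ∀ (k : ℕ) (G₁ : SimpleGraph (Fin k)) (c₁ : Fin k → ℕ) (G₂ : SimpleGraph (Fin k)) (c₂ : Fin k → ℕ)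
      (σ : G₁ ≃g G₂), (∀ v, c₂ (σ v) = c₁ v) →
        (S k).leafLabelings G₂ c₂ = ((S k).leafLabelings G₁ c₁).image fun e => e.trans σ.toEquiv :=
  ⟨fun k G col => (S k).leafLabelings_nonempty G col, fun k _ _ _ _ σ hσ => (S k).leafLabelings_colIso σ hσ⟩

end Literature.Computability.Complexity
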